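import Literature.NumberTheory.LFunctions.ZeroCounting
import Literature.NumberTheory.LFunctions.ZetaZerosProofs
import Literature.NumberTheory.DiophantineGeometry.NamedHypothesesProofs
import HarnessLib

/-!
# Consequences of the Riemann–von Mangoldt formula for `N(T)` and the ordinates `γ_n`

Trunk T-ANT (`Literature/NumberTheory/LFunctions`). Proofs only (no new definitions or named
facts): elementary consequences of the named fact `Literature.NumberTheory.LFunctions.riemann_von_mangoldt`
(`ZeroCounting.lean`, rh.S11: `N(T) = (T/2π) log(T/2π) − T/2π + O(log T)`) for the counting
function `N(T) = Literature.zetaZeroCount T` and the enumeration `γ_n = Literature.zetaOrdinate n` of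
`ZetaZeros.lean`, in the crude forms consumed by the dyadic-window bookkeeping of Rodgers–Tao
2020, §9 (`RodgersTaoProofs.lean`): orders of magnitude only, no asymptotic constants.

## Contents

* `Literature.NumberTheory.LFunctions.riemann_von_mangoldt.eventually_self_le` — eventually `T ≤ N(T)`;
  `Literature.NumberTheory.LFunctions.riemann_von_mangoldt.eventually_le_mul` — `N(T) ≤ C · T log T` eventually;
  `Literature.NumberTheory.LFunctions.riemann_von_mangoldt.tendsto_zetaZeroCount_atTop` — `N(T) → ∞`, i.e. R–vM implies the
  named fact `Literature.NumberTheory.LFunctions.tendsto_zetaZeroCount_atTop`.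
* `Literature.NumberTheory.LFunctions.zetaOrdinate_nonneg` — `0 ≤ γ_n`; `Literature.NumberTheory.LFunctions.exists_zetaZeroCount_add_eq` — `N` is
  right-continuous; `Literature.NumberTheory.LFunctions.bddBelow_setOf_succ_le_zetaZeroCount` (all unconditional).
* R–vM implies the bridge facts of `ZetaZeros.lean`:
  `Literature.NumberTheory.LFunctions.riemann_von_mangoldt.zetaZeroCount_eq_ncard` (`N(T) = #{n | γ_n ≤ T}`),
  `Literature.NumberTheory.LFunctions.riemann_von_mangoldt.zetaOrdinate_mono`, `Literature.NumberTheory.LFunctions.riemann_von_mangoldt.zetaOrdinate_pos`;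
  with the intermediate steps `….nonempty_setOf_succ_le`, `….succ_le_zetaZeroCount`
  (`n + 1 ≤ N(γ_n)`), `….zetaOrdinate_le_iff` (`γ_n ≤ T ↔ n + 1 ≤ N(T)`),
  `….zetaZeroCount_le_of_lt_zetaOrdinate` (`t < γ_n ⇒ N(t) ≤ n`).
* `Literature.NumberTheory.LFunctions.exists_log_zetaOrdinate_le` — `log γ_n ≤ log n + C₁` for all `n`;
  `Literature.NumberTheory.LFunctions.exists_log_le_log_zetaOrdinate` — `log(n + 1) ≤ log γ_n + log log γ_n + C₂` for
  `n ≥ n₀`; together `log γ_n ∼ log n` (Titchmarsh §9.3: `γ_n ∼ 2πn / log n`).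
* `Literature.NumberTheory.LFunctions.exists_abs_log_zetaOrdinate_div_sub_one_le` — the window form used in Rodgers–Tao §9:
  for `S ≥ S₁(η)` and `S log S ≤ n ≤ 2 S log S`, `|log γ_n / log S − 1| ≤ η`.
* Tools: `Literature.NumberTheory.LFunctions.log_le_log_of_nonneg`, `Literature.NumberTheory.LFunctions.exists_mul_log_eq` (`S ↦ S log S` maps `[1, ∞)`
  onto `[0, ∞)`), `Literature.NumberTheory.LFunctions.mul_log_lt_mul_log`, `Literature.NumberTheory.LFunctions.le_of_mul_log_le`.

* Bookkeeping between the zero-counting named facts (appended; Titchmarsh Thms. 9.3–9.4):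
  `Literature.NumberTheory.LFunctions.isBigO_zetaZeroCount_sub_backlund_of_stirling` — the Stirling expansion of `θ`
  (`Literature.NumberTheory.LFunctions.isBigO_riemannSiegelTheta_sub_stirling`) implies Backlund's form
  `Literature.NumberTheory.LFunctions.isBigO_zetaZeroCount_sub_backlund` (`S(T) := N(T) − θ(T)/π − 1` by definition);
  `Literature.NumberTheory.LFunctions.riemann_von_mangoldt_of_backlund` — Backlund's form and `S(T) = O(log T)`
  (`Literature.NumberTheory.LFunctions.isBigO_zetaArgS_log`) imply `Literature.NumberTheory.LFunctions.riemann_von_mangoldt`;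
  `Literature.NumberTheory.LFunctions.isBigO_zetaArgS_log_of_riemann_von_mangoldt`,
  `Literature.NumberTheory.LFunctions.riemann_von_mangoldt_iff_isBigO_zetaArgS_log_of_stirling` — conversely, so that given
  Stirling for `θ`, rh.S11 and `S(T) = O(log T)` are equivalent; `Literature.NumberTheory.LFunctions.isBigO_inv_log_atTop`.
* rh.S15 bookkeeping (appended): `Literature.NumberTheory.LFunctions.criticalZeroCount_div_zetaZeroCount_mem_Icc_holds`
  (`N₀(T)/N(T) ∈ [0, 1]`) and `Literature.NumberTheory.LFunctions.criticalLineProportion_mem_Icc_holds` (`0 ≤ κ ≤ 1`) discharge the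
  two named facts of `ZeroCounting.lean` whose interim proofs only needed `N₀ ≤ N`
  (`Literature.NumberTheory.DiophantineGeometry.criticalZeroCount_le_zetaZeroCount_holds`, `NamedHypothesesProofs.lean`).

* rh.S15 bookkeeping, continued (appended): the chain
  `Literature.NumberTheory.LFunctions.conrey_bound_of_przz_bound`,
  `Literature.NumberTheory.LFunctions.one_third_le_criticalLineProportion_of_conrey_bound`,
  `Literature.NumberTheory.LFunctions.criticalLineProportion_pos_of_one_third_le` (`κ > 5/12 ⇒ κ ≥ 0.4088 ⇒ κ ≥ 1/3 ⇒ κ > 0`);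
  and the passage from Levinson-method output to `κ` (Titchmarsh §10.28):
  `Literature.NumberTheory.LFunctions.le_criticalLineProportion_of_eventually_mul_le` (`N → ∞`, `αN(T) ≤ N₀(T)` for large `T`
  ⇒ `α ≤ κ`), `Literature.NumberTheory.LFunctions.le_criticalLineProportion_of_dyadic` (segment/dyadic form ⇒ `α ≤ κ`),
  and the reductions `Literature.NumberTheory.LFunctions.przz_bound_of_eventually_mul_le`,
  `Literature.NumberTheory.LFunctions.przz_bound_of_dyadic` of the named fact `przz_bound` (Pratt–Robles–Zaharescu–Zeindler
  2020) to the printed large-`T` / segment inequalities of PRZZ §8.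
## References

* E. C. Titchmarsh, *The Theory of the Riemann Zeta-Function*, 2nd ed. (1986), §9.1, Thm. 9.4
  and §9.3 (`γ_n ∼ 2πn / log n`).
* B. Rodgers, T. Tao, *The de Bruijn–Newman constant is non-negative*, Forum Math. Pi 8
  (2020), §9.
* E. C. Titchmarsh, op. cit., §4.17 and Thm. 9.3 (Backlund's form of the Riemann–von Mangoldt
  formula); R. J. Backlund, *Über die Nullstellen der Riemannschen Zetafunktion*, Acta Math. 41
  (1918).
* E. C. Titchmarsh, op. cit., §10.28 (Levinson's method: (10.28.1), (10.28.7), (10.28.11)).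
* K. Pratt, N. Robles, A. Zaharescu, D. Zeindler, *More than five-twelfths of the zeros of `ζ` are
  on the critical line*, Res. Math. Sci. 7 (2020), Paper No. 2 = arXiv:1802.10521 (§1.3,
  Thm. 1.2 of the arXiv text, Thm. 4.1, Thm. 7.1, §8). [PrattRoblesZaharescuZeindler2020]
-/

noncomputable section

open Real Filter Asymptotics Topology

namespace Literature.NumberTheory.LFunctions

/-! ## Orders of magnitude of `N(T)` -/

/-- From `N(T) = (T/2π) log(T/2π) − T/2π + O(log T)`: eventually `T ≤ N(T)` (indeed
`N(T)/T → ∞`; this crude form is all that is used below). [cite: Titchmarsh1986, Thm. 9.4] -/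
theorem riemann_von_mangoldt.eventually_self_le (h : riemann_von_mangoldt) :
    ∀ᶠ T : ℝ in atTop, T ≤ (zetaZeroCount T : ℝ) := by
  obtain ⟨C₀, hC₀, hbd⟩ := h.exists_pos
  have h2 : ∀ᶠ T : ℝ in atTop, 2 + 2 * π ≤ Real.log (T / (2 * π)) :=
    (Real.tendsto_log_atTop.comp (tendsto_id.atTop_div_const (by positivity))).eventually_ge_atTop
      _
  have h3 : ∀ᶠ T : ℝ in atTop, ‖Real.log T‖ ≤ (1 / (2 * π * C₀)) * ‖T‖ :=
    Real.isLittleO_log_id_atTop.def (by positivity)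
  filter_upwards [hbd.bound, h2, h3, eventually_ge_atTop (1 : ℝ)] with T hb h2 h3 h1
  rw [Real.norm_of_nonneg (Real.log_nonneg h1)] at hb h3
  rw [Real.norm_of_nonneg (by linarith : (0 : ℝ) ≤ T)] at h3
  rw [Real.norm_eq_abs] at hb
  have hb' := (abs_le.1 hb).1
  have h4 : T / (2 * π) * (2 + 2 * π) ≤ T / (2 * π) * Real.log (T / (2 * π)) :=
    mul_le_mul_of_nonneg_left h2 (by positivity)
  have h5 : C₀ * Real.log T ≤ T / (2 * π) := by
    calc C₀ * Real.log T ≤ C₀ * ((1 / (2 * π * C₀)) * T) :=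
          mul_le_mul_of_nonneg_left h3 hC₀.le
      _ = T / (2 * π) := by field_simp
  have h6 : T / (2 * π) * (2 + 2 * π) = 2 * (T / (2 * π)) + T := by field_simp
  linarith

/-- From the Riemann–von Mangoldt formula: `N(T) ≤ C · T log T` for some `C > 0` and all large
`T`. [cite: Titchmarsh1986, Thm. 9.4] -/
theorem riemann_von_mangoldt.eventually_le_mul (h : riemann_von_mangoldt) :
    ∃ C : ℝ, 0 < C ∧ ∀ᶠ T : ℝ in atTop, (zetaZeroCount T : ℝ) ≤ C * (T * Real.log T) := by
  obtain ⟨C₀, hC₀, hbd⟩ := h.exists_pos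
  refine ⟨1 / (2 * π) + C₀, by positivity, ?_⟩
  filter_upwards [hbd.bound, eventually_ge_atTop (1 : ℝ)] with T hb h1
  have hlog : 0 ≤ Real.log T := Real.log_nonneg h1
  rw [Real.norm_of_nonneg hlog, Real.norm_eq_abs] at hb
  have hb' := (abs_le.1 hb).2
  have h2 : Real.log (T / (2 * π)) ≤ Real.log T :=
    Real.log_le_log (by positivity) (div_le_self (by linarith) (by linarith [pi_gt_three]))
  have h3 : T / (2 * π) * Real.log (T / (2 * π)) ≤ T / (2 * π) * Real.log T :=
    mul_le_mul_of_nonneg_left h2 (by positivity)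
  have h4 : Real.log T ≤ T * Real.log T := le_mul_of_one_le_left hlog h1
  have h5 : 0 ≤ T / (2 * π) := by positivity
  have h6 : (1 / (2 * π) + C₀) * (T * Real.log T) =
      T / (2 * π) * Real.log T + C₀ * (T * Real.log T) := by ring
  nlinarith

/-- The Riemann–von Mangoldt formula implies `N(T) → ∞` (`T → ∞`), i.e. the named fact
`Literature.NumberTheory.LFunctions.tendsto_zetaZeroCount_atTop` of `ZetaZeros.lean`. [cite: Titchmarsh1986, Thm. 9.4] -/
theorem riemann_von_mangoldt.tendsto_zetaZeroCount_atTop (h : riemann_von_mangoldt) :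
    tendsto_zetaZeroCount_atTop :=
  tendsto_natCast_atTop_iff.1 (tendsto_atTop_mono' atTop h.eventually_self_le tendsto_id)

/-! ## The enumeration `γ_n` versus the counting function `N(T)` -/

/-- `0 ≤ γ_n` unconditionally: `γ_n = sInf {T | n + 1 ≤ N(T)}`, every member of that set is
positive since `N(T) = 0` for `T ≤ 0` (`zetaZeroCount_eq_zero_of_nonpos`), and `sInf ∅ = 0`.
[folklore] -/
theorem zetaOrdinate_nonneg (n : ℕ) : 0 ≤ zetaOrdinate n := by
  refine Real.sInf_nonneg fun T hT ↦ ?_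
  by_contra hT0
  have h0 := zetaZeroCount_eq_zero_of_nonpos (not_le.1 hT0).le
  simp only [Set.mem_setOf_eq, h0] at hT
  omega

/-- Right-continuity of `N`: for every `T` there is `δ > 0` with `N(T + δ) = N(T)` (the zeros
in the box up to height `T + 1` are finitely many, so none has ordinate in `(T, T + δ]` for
small `δ > 0`). [cite: Titchmarsh1986, §9.1] -/
theorem exists_zetaZeroCount_add_eq (T : ℝ) :
    ∃ δ : ℝ, 0 < δ ∧ zetaZeroCount (T + δ) = zetaZeroCount T := by
  have hF : (zetaZeroBox 0 (T + 1)).Finite := zetaZeroBox_finite 0 (T + 1)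
  have hev : ∀ᶠ δ : ℝ in 𝓝[>] 0, ∀ ρ ∈ zetaZeroBox 0 (T + 1), T < ρ.im → T + δ < ρ.im := by
    rw [hF.eventually_all]
    intro ρ _
    by_cases him : T < ρ.im
    · have hc : ContinuousAt (fun δ : ℝ ↦ T + δ) 0 :=
        (continuous_const.add continuous_id).continuousAt
      have : ∀ᶠ δ : ℝ in 𝓝 0, T + δ < ρ.im :=
        hc.eventually_lt continuousAt_const (by simpa using him)
      exact (this.filter_mono nhdsWithin_le_nhds).mono fun δ h _ ↦ h
    · exact Eventually.of_forall fun δ h ↦ absurd h him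
  obtain ⟨δ, hδ, hδ01⟩ := (hev.and (Ioc_mem_nhdsGT (zero_lt_one' ℝ))).exists
  refine ⟨δ, hδ01.1, ?_⟩
  have hbox : zetaZeroBox 0 (T + δ) = zetaZeroBox 0 T := by
    ext ρ
    simp only [zetaZeroBox, Set.mem_setOf_eq]
    constructor
    · rintro ⟨h0, h1, h2, h3, h4⟩
      refine ⟨h0, h1, h2, h3, ?_⟩
      by_contra hT
      have hmem : ρ ∈ zetaZeroBox 0 (T + 1) :=
        ⟨h0, h1, h2, h3, h4.trans (by linarith [hδ01.2])⟩
      linarith [hδ ρ hmem (not_le.1 hT)]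
    · rintro ⟨h0, h1, h2, h3, h4⟩
      exact ⟨h0, h1, h2, h3, h4.trans (by linarith [hδ01.1])⟩
  simp only [zetaZeroCount, zetaZeroCountRe, hbox]

/-- The defining sets `{T | n + 1 ≤ N(T)}` of the ordinates `γ_n` are bounded below (by `0`,
as `N(T) = 0` for `T ≤ 0`). [folklore] -/
theorem bddBelow_setOf_succ_le_zetaZeroCount (n : ℕ) :
    BddBelow {T | n + 1 ≤ zetaZeroCount T} := by
  refine ⟨0, fun T hT ↦ ?_⟩
  by_contra h0
  have := zetaZeroCount_eq_zero_of_nonpos (not_le.1 h0).le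
  simp only [Set.mem_setOf_eq, this] at hT
  omega

/-- Under R–vM the defining sets `{T | n + 1 ≤ N(T)}` of the ordinates are nonempty.
[folklore] -/
theorem riemann_von_mangoldt.nonempty_setOf_succ_le (h : riemann_von_mangoldt) (n : ℕ) :
    {T | n + 1 ≤ zetaZeroCount T}.Nonempty :=
  (Filter.Tendsto.eventually_ge_atTop (show Tendsto zetaZeroCount atTop atTop from
    h.tendsto_zetaZeroCount_atTop) (n + 1)).exists

/-- Under R–vM the infimum defining `γ_n` is attained: `n + 1 ≤ N(γ_n)` (right-continuity of
`N`). [cite: Titchmarsh1986, §9.1] -/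
theorem riemann_von_mangoldt.succ_le_zetaZeroCount (h : riemann_von_mangoldt) (n : ℕ) :
    n + 1 ≤ zetaZeroCount (zetaOrdinate n) := by
  obtain ⟨δ, hδ, heq⟩ := exists_zetaZeroCount_add_eq (zetaOrdinate n)
  have hlt : sInf {T | n + 1 ≤ zetaZeroCount T} < zetaOrdinate n + δ := by
    change zetaOrdinate n < zetaOrdinate n + δ
    linarith
  obtain ⟨T', hT', hT'lt⟩ := exists_lt_of_csInf_lt (h.nonempty_setOf_succ_le n) hlt
  rw [← heq]
  exact le_trans hT' (zetaZeroCount_mono hT'lt.le)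

/-- Under R–vM: `γ_n ≤ T ↔ n + 1 ≤ N(T)`. [cite: Titchmarsh1986, §9.1] -/
theorem riemann_von_mangoldt.zetaOrdinate_le_iff (h : riemann_von_mangoldt) {n : ℕ} {T : ℝ} :
    zetaOrdinate n ≤ T ↔ n + 1 ≤ zetaZeroCount T :=
  ⟨fun hle ↦ (h.succ_le_zetaZeroCount n).trans (zetaZeroCount_mono hle),
    fun hT ↦ csInf_le (bddBelow_setOf_succ_le_zetaZeroCount n) hT⟩

/-- Under R–vM: if `t < γ_n` then `N(t) ≤ n`. [cite: Titchmarsh1986, §9.1] -/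
theorem riemann_von_mangoldt.zetaZeroCount_le_of_lt_zetaOrdinate (h : riemann_von_mangoldt)
    {t : ℝ} {n : ℕ} (ht : t < zetaOrdinate n) : zetaZeroCount t ≤ n := by
  by_contra hlt
  exact absurd (h.zetaOrdinate_le_iff.2 (by omega)) (not_le.2 ht)

/-- The Riemann–von Mangoldt formula implies the bridge fact `Literature.NumberTheory.LFunctions.zetaZeroCount_eq_ncard`
(`N(T) = #{n | γ_n ≤ T}`; `ZetaZeros.lean`): indeed `{n | γ_n ≤ T} = {n | n < N(T)}`.
[cite: Titchmarsh1986, §9.1] -/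
theorem riemann_von_mangoldt.zetaZeroCount_eq_ncard (h : riemann_von_mangoldt) :
    zetaZeroCount_eq_ncard := by
  intro T
  have hset : {n | zetaOrdinate n ≤ T} = Set.Iio (zetaZeroCount T) := by
    ext n
    simp only [Set.mem_setOf_eq, Set.mem_Iio, h.zetaOrdinate_le_iff, Nat.succ_le_iff]
  rw [hset]
  simp

/-- The Riemann–von Mangoldt formula implies the named fact `Literature.NumberTheory.LFunctions.zetaOrdinate_mono` (the
ordinates are non-decreasing): the defining sets `{T | n + 1 ≤ N(T)}` decrease with `n` and are
nonempty. [cite: Titchmarsh1986, §9.1] -/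
theorem riemann_von_mangoldt.zetaOrdinate_mono (h : riemann_von_mangoldt) : zetaOrdinate_mono :=
  fun m k hmk ↦ csInf_le_csInf (bddBelow_setOf_succ_le_zetaZeroCount m)
    (h.nonempty_setOf_succ_le k) fun T (hT : k + 1 ≤ zetaZeroCount T) ↦
      show m + 1 ≤ zetaZeroCount T by omega

/-- The Riemann–von Mangoldt formula implies the named fact `Literature.NumberTheory.LFunctions.zetaOrdinate_pos` (`0 < γ_n`):
`N(γ_n) ≥ n + 1 ≥ 1` while `N(T) = 0` for `T ≤ 0`. [cite: Titchmarsh1986, §9.1] -/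
theorem riemann_von_mangoldt.zetaOrdinate_pos (h : riemann_von_mangoldt) : zetaOrdinate_pos := by
  intro n
  by_contra h0
  have := h.succ_le_zetaZeroCount n
  rw [zetaZeroCount_eq_zero_of_nonpos (not_lt.1 h0)] at this
  omega

/-! ## `log γ_n ∼ log n` -/

/-- `log x ≤ log y` for `0 ≤ x ≤ y` and `1 ≤ y` (covering `x = 0`, where `log 0 = 0`).
[folklore] -/
theorem log_le_log_of_nonneg {x y : ℝ} (hx : 0 ≤ x) (hxy : x ≤ y) (hy : 1 ≤ y) :
    Real.log x ≤ Real.log y := by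
  rcases hx.eq_or_lt with rfl | hx'
  · simpa using Real.log_nonneg hy
  · exact Real.log_le_log hx' hxy

/-- Upper bound for the ordinates: there is `C₁ ≥ 0` with `log γ_n ≤ log n + C₁` for every `n`
(from `N(t) ≥ t` for large `t` and `N(t) ≤ n` for `t < γ_n`, whence `γ_n ≤ max(T₁, n)`).
[cite: Titchmarsh1986, §9.3] -/
theorem exists_log_zetaOrdinate_le (h : riemann_von_mangoldt) :
    ∃ C₁ : ℝ, 0 ≤ C₁ ∧ ∀ n : ℕ, Real.log (zetaOrdinate n) ≤ Real.log n + C₁ := by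
  obtain ⟨T₁, hT₁⟩ := eventually_atTop.1 (h.eventually_self_le.and (eventually_ge_atTop (1 : ℝ)))
  have hT₁1 : 1 ≤ T₁ := (hT₁ T₁ le_rfl).2
  refine ⟨Real.log T₁, Real.log_nonneg hT₁1, fun n ↦ ?_⟩
  have hle : zetaOrdinate n ≤ max T₁ n := by
    by_contra hlt
    push Not at hlt
    set t : ℝ := (max T₁ n + zetaOrdinate n) / 2 with ht
    have ht1 : max T₁ (n : ℝ) < t := by rw [ht]; linarith
    have ht2 : t < zetaOrdinate n := by rw [ht]; linarith
    have hN : t ≤ zetaZeroCount t := (hT₁ t ((le_max_left _ _).trans ht1.le)).1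
    have hN' : (zetaZeroCount t : ℝ) ≤ n := by
      exact_mod_cast h.zetaZeroCount_le_of_lt_zetaOrdinate ht2
    linarith [le_max_right T₁ (n : ℝ)]
  have hn0 : 0 ≤ Real.log (n : ℝ) := Real.log_natCast_nonneg n
  have hlog : Real.log (zetaOrdinate n) ≤ Real.log (max T₁ n) :=
    log_le_log_of_nonneg (zetaOrdinate_nonneg n) hle (hT₁1.trans (le_max_left _ _))
  rcases le_total T₁ n with hTn | hTn
  · rw [max_eq_right hTn] at hlog
    linarith [Real.log_nonneg hT₁1]
  · rw [max_eq_left hTn] at hlog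
    linarith

/-- Lower bound for the ordinates: there are `n₀` and `C₂ ≥ 0` such that for `n ≥ n₀`,
`γ_n ≥ e` and `log(n + 1) ≤ log γ_n + log log γ_n + C₂` (from `n + 1 ≤ N(γ_n) ≤ C γ_n log γ_n`).
[cite: Titchmarsh1986, §9.3] -/
theorem exists_log_le_log_zetaOrdinate (h : riemann_von_mangoldt) :
    ∃ n₀ : ℕ, ∃ C₂ : ℝ, 0 ≤ C₂ ∧ ∀ n : ℕ, n₀ ≤ n →
      Real.exp 1 ≤ zetaOrdinate n ∧
      Real.log ((n : ℝ) + 1) ≤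
        Real.log (zetaOrdinate n) + Real.log (Real.log (zetaOrdinate n)) + C₂ := by
  obtain ⟨C, hC, hev⟩ := h.eventually_le_mul
  obtain ⟨T₂, hT₂⟩ := eventually_atTop.1 (hev.and (eventually_ge_atTop (Real.exp 1)))
  refine ⟨zetaZeroCount T₂, max (Real.log C) 0, le_max_right _ _, fun n hn ↦ ?_⟩
  have hsucc := h.succ_le_zetaZeroCount n
  have hγ : T₂ ≤ zetaOrdinate n := by
    by_contra hlt
    have := zetaZeroCount_mono (not_le.1 hlt).le
    omega
  obtain ⟨hNle, hT₂e⟩ := hT₂ _ hγ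
  have hγpos : 0 < zetaOrdinate n := (Real.exp_pos 1).trans_le hT₂e
  have hlogγ : 1 ≤ Real.log (zetaOrdinate n) := by
    rwa [Real.le_log_iff_exp_le hγpos]
  refine ⟨hT₂e, ?_⟩
  have h1 : (n : ℝ) + 1 ≤ C * (zetaOrdinate n * Real.log (zetaOrdinate n)) := by
    have : ((n + 1 : ℕ) : ℝ) ≤ (zetaZeroCount (zetaOrdinate n) : ℝ) := by exact_mod_cast hsucc
    push_cast at this
    exact this.trans hNle
  have h2 := Real.log_le_log (by positivity) h1
  rw [Real.log_mul hC.ne' (by positivity), Real.log_mul hγpos.ne' (by positivity)] at h2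
  linarith [le_max_left (Real.log C) 0]

/-- Window form of `log γ_n ∼ log n` (the normalisation bookkeeping of Rodgers–Tao 2020, §9):
for every `η > 0` there is `S₁ ≥ 1` such that for all `S ≥ S₁` and all `n` with
`S log S ≤ n ≤ 2 S log S` one has `log S > 0`, `log γ_n > 0` and `|log γ_n / log S − 1| ≤ η`.
[cite: RodgersTaoFMP2020, §9] -/
theorem exists_abs_log_zetaOrdinate_div_sub_one_le (h : riemann_von_mangoldt) {η : ℝ}
    (hη : 0 < η) :
    ∃ S₁ : ℝ, 1 ≤ S₁ ∧ ∀ S : ℝ, S₁ ≤ S → ∀ n : ℕ, S * Real.log S ≤ n →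
      (n : ℝ) ≤ 2 * (S * Real.log S) →
        0 < Real.log S ∧ 0 < Real.log (zetaOrdinate n) ∧
          |Real.log (zetaOrdinate n) / Real.log S - 1| ≤ η := by
  obtain ⟨C₁, hC₁, hup⟩ := exists_log_zetaOrdinate_le h
  obtain ⟨n₀, C₂, hC₂, hlow⟩ := exists_log_le_log_zetaOrdinate h
  have e1 : ∀ᶠ S : ℝ in atTop, Real.log (Real.log S) ≤ η / 2 * Real.log S := by
    have hlo := Real.isLittleO_log_id_atTop.def (half_pos hη)
    filter_upwards [Real.tendsto_log_atTop.eventually hlo,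
      Real.tendsto_log_atTop.eventually (eventually_ge_atTop (0 : ℝ))] with S hS hS0
    rw [id, Real.norm_of_nonneg hS0] at hS
    exact (le_abs_self _).trans ((Real.norm_eq_abs _).symm.le.trans hS)
  have e2 : ∀ᶠ S : ℝ in atTop,
      Real.log 2 + C₁ + Real.log (1 + η) + C₂ ≤ η / 2 * Real.log S :=
    (Real.tendsto_log_atTop.const_mul_atTop (half_pos hη)).eventually_ge_atTop _
  obtain ⟨S₁, hS₁⟩ := eventually_atTop.1
    (e1.and (e2.and ((eventually_ge_atTop (n₀ : ℝ)).and (eventually_ge_atTop (Real.exp 1)))))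
  refine ⟨max S₁ 1, le_max_right _ _, fun S hS n hn1 hn2 ↦ ?_⟩
  obtain ⟨h1, h2, h3, h4⟩ := hS₁ S ((le_max_left _ _).trans hS)
  have hSpos : 0 < S := (Real.exp_pos 1).trans_le h4
  have hS1 : 1 ≤ Real.log S := by rwa [Real.le_log_iff_exp_le hSpos]
  have hSlogS : S ≤ S * Real.log S := le_mul_of_one_le_right hSpos.le hS1
  have hn₀ : n₀ ≤ n := by exact_mod_cast h3.trans (hSlogS.trans hn1)
  have hnpos : (0 : ℝ) < n := by linarith
  obtain ⟨hγe, hlow'⟩ := hlow n hn₀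
  have hγpos : 0 < zetaOrdinate n := (Real.exp_pos 1).trans_le hγe
  have hlogγ : 1 ≤ Real.log (zetaOrdinate n) := by rwa [Real.le_log_iff_exp_le hγpos]
  have hlog2 : 0 ≤ Real.log 2 := Real.log_nonneg one_le_two
  have hlog1η : 0 ≤ Real.log (1 + η) := Real.log_nonneg (by linarith)
  -- upper bound `log γ_n ≤ (1 + η) log S`
  have hupper : Real.log (zetaOrdinate n) ≤ (1 + η) * Real.log S := by
    have hlogn : Real.log n ≤ Real.log 2 + Real.log S + Real.log (Real.log S) := by
      rw [← Real.log_mul (by norm_num) hSpos.ne', ← Real.log_mul (by positivity) (by positivity)]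
      exact Real.log_le_log hnpos (by linarith)
    linarith [hup n]
  -- lower bound `(1 - η) log S ≤ log γ_n`
  have hlower : (1 - η) * Real.log S ≤ Real.log (zetaOrdinate n) := by
    have hlogn : Real.log S + Real.log (Real.log S) ≤ Real.log n := by
      rw [← Real.log_mul hSpos.ne' (by positivity)]
      exact Real.log_le_log (by positivity) hn1
    have hlogn1 : Real.log n ≤ Real.log (n + 1) := Real.log_le_log hnpos (by linarith)
    have hll : Real.log (Real.log (zetaOrdinate n)) ≤
        Real.log (1 + η) + Real.log (Real.log S) := by
      rw [← Real.log_mul (by positivity) (by positivity)]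
      exact Real.log_le_log (by positivity) hupper
    linarith
  have hlogSpos : 0 < Real.log S := by linarith
  refine ⟨hlogSpos, by linarith, ?_⟩
  rw [div_sub_one hlogSpos.ne', abs_div, abs_of_pos hlogSpos, div_le_iff₀ hlogSpos, abs_le]
  constructor <;> linarith

/-! ## Tools: the map `S ↦ S log S` -/

/-- `S ↦ S log S` maps `[1, ∞)` onto `[0, ∞)` (intermediate value theorem). [folklore] -/
theorem exists_mul_log_eq {y : ℝ} (hy : 0 ≤ y) : ∃ S : ℝ, 1 ≤ S ∧ S * Real.log S = y := by
  set b : ℝ := max y (Real.exp 1) with hb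
  have hb1 : 1 ≤ b := le_trans (by nlinarith [Real.add_one_le_exp (1 : ℝ)]) (le_max_right _ _)
  have hcont : ContinuousOn (fun x : ℝ ↦ x * Real.log x) (Set.Icc 1 b) :=
    Real.continuous_mul_log.continuousOn
  have hmem : y ∈ Set.Icc ((fun x : ℝ ↦ x * Real.log x) 1) ((fun x : ℝ ↦ x * Real.log x) b) := by
    refine ⟨by simp [hy], ?_⟩
    have hlogb : 1 ≤ Real.log b := by
      rw [Real.le_log_iff_exp_le (by positivity)]; exact le_max_right _ _
    change y ≤ b * Real.log b
    nlinarith [le_max_left y (Real.exp 1)]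
  obtain ⟨S, hS, hSy⟩ := intermediate_value_Icc hb1 hcont hmem
  exact ⟨S, hS.1, hSy⟩

/-- Strict monotonicity of `S ↦ S log S` on `[1, ∞)`. [folklore] -/
theorem mul_log_lt_mul_log {a b : ℝ} (ha : 1 ≤ a) (hab : a < b) :
    a * Real.log a < b * Real.log b := by
  have hb : 0 < Real.log b := Real.log_pos (by linarith)
  calc a * Real.log a ≤ a * Real.log b :=
        mul_le_mul_of_nonneg_left (Real.log_le_log (by linarith) hab.le) (by linarith)
    _ < b * Real.log b := mul_lt_mul_of_pos_right hab hb

/-- If `1 ≤ S` and `a log a ≤ S log S` then `a ≤ S`. [folklore] -/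
theorem le_of_mul_log_le {a S : ℝ} (hS : 1 ≤ S) (h : a * Real.log a ≤ S * Real.log S) :
    a ≤ S := by
  by_contra hlt
  exact absurd h (not_le.2 (mul_log_lt_mul_log hS (not_le.1 hlt)))

/-! ## Bookkeeping between the zero-counting named facts

`ZeroCounting.lean` records the Riemann–von Mangoldt formula and its Backlund refinement as named
facts, and `RiemannSiegel.lean` / `ZetaZeros.lean` record the Stirling expansion of `θ` and
`S(T) = O(log T)` as named facts. The analytic content is concentrated in two of them — the
Stirling expansion `Literature.NumberTheory.LFunctions.isBigO_riemannSiegelTheta_sub_stirling` and the bound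
`Literature.NumberTheory.LFunctions.isBigO_zetaArgS_log` — and the implications below show that discharging those two
discharges `Literature.NumberTheory.LFunctions.isBigO_zetaZeroCount_sub_backlund` and `Literature.NumberTheory.LFunctions.riemann_von_mangoldt` (and hence,
by `Literature.NumberTheory.LFunctions.riemann_von_mangoldt.tendsto_zetaZeroCount_atTop` above, `Literature.NumberTheory.LFunctions.tendsto_zetaZeroCount_atTop`
and the ordinates API). -/

/-- **Stirling for `θ` ⇒ Backlund's form of the Riemann–von Mangoldt formula.** Since
`S(T) = N(T) − θ(T)/π − 1` by definition, the difference
`N(T) − ((T/2π) log(T/2π) − T/2π + 7/8 + S(T))` equals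
`π⁻¹ (θ(T) − ((T/2) log(T/2π) − T/2 − π/8))`, which is `O(1/T)` by the Stirling expansion of
`θ` (Titchmarsh §4.17, Thm. 9.3). This is the interim proof recorded in `ZeroCounting.lean`.
[cite: Titchmarsh1986, Thm. 9.3] -/
theorem isBigO_zetaZeroCount_sub_backlund_of_stirling (h : isBigO_riemannSiegelTheta_sub_stirling) :
    isBigO_zetaZeroCount_sub_backlund := by
  have h' := h.const_mul_left (1 / π)
  refine h'.congr_left fun T ↦ ?_
  simp only [zetaArgS]
  field_simp
  ring

/-- `T⁻¹ = O(log T)` as `T → ∞` (indeed `o`). [folklore] -/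
theorem isBigO_inv_log_atTop : (fun T : ℝ ↦ T⁻¹) =O[atTop] Real.log :=
  (tendsto_inv_atTop_zero.isBigO_one ℝ).trans
    (Real.isLittleO_const_log_atTop (c := (1 : ℝ))).isBigO

/-- **Backlund's form and `S(T) = O(log T)` ⇒ the Riemann–von Mangoldt formula** (rh.S11):
`N(T) − ((T/2π) log(T/2π) − T/2π) = [N(T) − (… + 7/8 + S(T))] + 7/8 + S(T)`, which is
`O(1/T) + O(1) + O(log T) = O(log T)`. (Titchmarsh Thm. 9.4.) [cite: Titchmarsh1986, Thm. 9.4] -/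
theorem riemann_von_mangoldt_of_backlund (h1 : isBigO_zetaZeroCount_sub_backlund)
    (h2 : isBigO_zetaArgS_log) : riemann_von_mangoldt := by
  have h3 : (fun _ : ℝ ↦ (7 / 8 : ℝ)) =O[atTop] Real.log :=
    (Real.isLittleO_const_log_atTop (c := (7 / 8 : ℝ))).isBigO
  have h := (h1.trans isBigO_inv_log_atTop).add (h3.add h2)
  refine h.congr_left fun T ↦ ?_
  ring

/-- **Conversely, the Riemann–von Mangoldt formula and Stirling for `θ` give `S(T) = O(log T)`**:
`S(T) = [N(T) − ((T/2π) log(T/2π) − T/2π)] − [N(T) − (… + 7/8 + S(T))] − 7/8 = O(log T) +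
O(1/T) + O(1)`. (Titchmarsh Thm. 9.4.) [cite: Titchmarsh1986, Thm. 9.4] -/
theorem isBigO_zetaArgS_log_of_riemann_von_mangoldt (h1 : riemann_von_mangoldt)
    (h2 : isBigO_riemannSiegelTheta_sub_stirling) : isBigO_zetaArgS_log := by
  have h3 : (fun _ : ℝ ↦ (7 / 8 : ℝ)) =O[atTop] Real.log :=
    (Real.isLittleO_const_log_atTop (c := (7 / 8 : ℝ))).isBigO
  have h4 := (isBigO_zetaZeroCount_sub_backlund_of_stirling h2).trans isBigO_inv_log_atTop
  have h := (h1.sub h4).sub h3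
  refine h.congr_left fun T ↦ ?_
  ring

/-- Given the Stirling expansion of `θ`, the Riemann–von Mangoldt formula (rh.S11) holds iff
`S(T) = O(log T)`: the two named facts are equivalent bookkeeping forms of one another. (Only the
first-order consequence `θ(T) = (T/2) log(T/2π) − T/2 + O(log T)` of Stirling is really needed;
see `RiemannSiegelThetaBounds.lean`.) [cite: Titchmarsh1986, Thm. 9.4] -/
theorem riemann_von_mangoldt_iff_isBigO_zetaArgS_log_of_stirling
    (h : isBigO_riemannSiegelTheta_sub_stirling) : riemann_von_mangoldt ↔ isBigO_zetaArgS_log :=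
  ⟨fun h1 ↦ isBigO_zetaArgS_log_of_riemann_von_mangoldt h1 h,
    fun h2 ↦ riemann_von_mangoldt_of_backlund (isBigO_zetaZeroCount_sub_backlund_of_stirling h) h2⟩

/-! ## rh.S15 bookkeeping: `N₀(T)/N(T) ∈ [0, 1]` and `0 ≤ κ ≤ 1` -/

/-- The ratio `N₀(T)/N(T)` lies in `[0, 1]` for every `T` — discharge of the named fact
`Literature.NumberTheory.LFunctions.criticalZeroCount_div_zetaZeroCount_mem_Icc` (`ZeroCounting.lean`), from `N₀(T) ≤ N(T)`
(`criticalZeroCount_le_zetaZeroCount_holds`, `NamedHypothesesProofs.lean`); this is the interim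
proof recorded in `ZeroCounting.lean`. [folklore] -/
theorem criticalZeroCount_div_zetaZeroCount_mem_Icc_holds :
    criticalZeroCount_div_zetaZeroCount_mem_Icc := by
  intro T
  refine ⟨by positivity, ?_⟩
  rcases Nat.eq_zero_or_pos (zetaZeroCount T) with h | h
  · simp [h]
  · rw [div_le_one (by exact_mod_cast h)]
    exact_mod_cast DiophantineGeometry.criticalZeroCount_le_zetaZeroCount_holds T

/-- `0 ≤ κ ≤ 1` for the critical-line proportion `κ = liminf N₀(T)/N(T)` — discharge of the named
fact `Literature.NumberTheory.LFunctions.criticalLineProportion_mem_Icc` (`ZeroCounting.lean`); the interim proof recorded there.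
[folklore] -/
theorem criticalLineProportion_mem_Icc_holds : criticalLineProportion_mem_Icc := by
  have hI := criticalZeroCount_div_zetaZeroCount_mem_Icc_holds
  have hb : IsBoundedUnder (· ≥ ·) atTop
      (fun T : ℝ ↦ (criticalZeroCount T : ℝ) / zetaZeroCount T) :=
    isBoundedUnder_of ⟨0, fun T ↦ (hI T).1⟩
  have hc : IsCoboundedUnder (· ≥ ·) atTop
      (fun T : ℝ ↦ (criticalZeroCount T : ℝ) / zetaZeroCount T) :=
    isCoboundedUnder_ge_of_le atTop (x := 1) fun T ↦ (hI T).2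
  refine ⟨?_, ?_⟩
  · exact le_liminf_of_le hc (Eventually.of_forall fun T ↦ (hI T).1)
  · exact liminf_le_of_le hb fun b hb' ↦ by
      obtain ⟨T, hT⟩ := hb'.exists
      exact hT.trans (hI T).2

/-! ## rh.S15 bookkeeping: the chain PRZZ ⇒ Conrey ⇒ Levinson ⇒ Selberg, and the passage from
Levinson-method output to `κ` (Titchmarsh §10.28)

The four named facts of `ZeroCounting.lean` about `κ = criticalLineProportion` are nested
(`5/12 > 0.4088 > 1/3 > 0`), so a discharge of the strongest, `przz_bound`
(Pratt–Robles–Zaharescu–Zeindler, *Res. Math. Sci.* 7 (2020) = arXiv:1802.10521, Thm. 1.2 of the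
arXiv text, cited in the tree as Thm. 1.1: "More than five twelfths of the non-trivial zeros of the
Riemann zeta-function are on the critical line"; §8: `κ ≥ 0.417293962`), closes all four.

Levinson's method (Titchmarsh–Heath-Brown §10.28) does not produce the `liminf` directly: its
output is either the large-`T` inequality "(10.28.1) `N₀(T) ≥ α N(T)` for large enough `T`", or,
one step earlier, the segment inequality
`N₀(T₂) − N₀(T₁) ≥ (1 − log c(a)/a + o(1)) {N(T₂) − N(T₁)}` ((10.28.7) with (10.28.11)) on
suitable segments. The lemmas below are the bookkeeping from either form to a lower bound for
`κ = liminf N₀(T)/N(T)`; the only analytic input is `N(T) → ∞`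
(the named fact `tendsto_zetaZeroCount_atTop`, itself a consequence of the Riemann–von Mangoldt
formula, `riemann_von_mangoldt.tendsto_zetaZeroCount_atTop` above). They reduce `przz_bound` to the
printed output of PRZZ §8 (`przz_bound_of_eventually_mul_le`, `przz_bound_of_dyadic`); the
analytic heart of PRZZ (Levinson's inequality
`κ ≥ 1 − R⁻¹ log(T⁻¹ ∫_1^T |Vψ(σ₀+it)|² dt) + o(1)` of §1.3, the twisted second moment
Thm. 4.1 at length `θ = 4/7 − ε`, the main terms Thm. 7.1 and the numerical evaluation of §8)
is not formalised here. -/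

/-- `κ > 5/12 ⇒ κ ≥ 0.4088` (`0.4088 < 5/12 = 0.41666…`): the Pratt–Robles–Zaharescu–Zeindler
bound implies Conrey's bound. [folklore] -/
theorem conrey_bound_of_przz_bound (h : przz_bound) : conrey_bound := by
  unfold conrey_bound
  unfold przz_bound at h
  have h1 : (0.4088 : ℝ) ≤ 5 / 12 := by norm_num
  exact h1.trans h.le

/-- `κ ≥ 0.4088 ⇒ κ ≥ 1/3`: Conrey's bound implies Levinson's. [folklore] -/
theorem one_third_le_criticalLineProportion_of_conrey_bound (h : conrey_bound) :
    one_third_le_criticalLineProportion := by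
  unfold one_third_le_criticalLineProportion
  unfold conrey_bound at h
  have h1 : (1 / 3 : ℝ) ≤ 0.4088 := by norm_num
  exact h1.trans h

/-- `κ ≥ 1/3 ⇒ κ > 0`: Levinson's bound implies Selberg's positive proportion. [folklore] -/
theorem criticalLineProportion_pos_of_one_third_le (h : one_third_le_criticalLineProportion) :
    criticalLineProportion_pos := by
  unfold criticalLineProportion_pos
  unfold one_third_le_criticalLineProportion at h
  linarith

/-- `κ > 5/12` implies all three earlier critical-line proportion facts at once. [folklore] -/
theorem przz_bound.conrey_levinson_selberg (h : przz_bound) :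
    conrey_bound ∧ one_third_le_criticalLineProportion ∧ criticalLineProportion_pos :=
  ⟨conrey_bound_of_przz_bound h,
    one_third_le_criticalLineProportion_of_conrey_bound (conrey_bound_of_przz_bound h),
    criticalLineProportion_pos_of_one_third_le
      (one_third_le_criticalLineProportion_of_conrey_bound (conrey_bound_of_przz_bound h))⟩

/-- **From "(10.28.1) for large `T`" to `κ`.** If `N(T) → ∞` and `α N(T) ≤ N₀(T)` for all large
`T`, then `α ≤ κ = liminf N₀(T)/N(T)`. (`N(T) → ∞` is needed only to make `N(T) > 0` eventually,
so that the ratio is a genuine quotient; Titchmarsh §10.28, (10.28.1).)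
[cite: Titchmarsh1986, §10.28 (10.28.1)] -/
theorem le_criticalLineProportion_of_eventually_mul_le (hN : tendsto_zetaZeroCount_atTop) {α : ℝ}
    (h : ∀ᶠ T : ℝ in atTop, α * (zetaZeroCount T : ℝ) ≤ criticalZeroCount T) :
    α ≤ criticalLineProportion := by
  have hI := criticalZeroCount_div_zetaZeroCount_mem_Icc_holds
  have hc : IsCoboundedUnder (· ≥ ·) atTop
      (fun T : ℝ ↦ (criticalZeroCount T : ℝ) / zetaZeroCount T) :=
    isCoboundedUnder_ge_of_le atTop (x := 1) fun T ↦ (hI T).2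
  have hN' : Tendsto zetaZeroCount atTop atTop := hN
  have hpos : ∀ᶠ T : ℝ in atTop, (0 : ℝ) < zetaZeroCount T := by
    filter_upwards [hN'.eventually_ge_atTop 1] with T hT
    exact_mod_cast hT
  unfold criticalLineProportion
  refine le_liminf_of_le hc ?_
  filter_upwards [h, hpos] with T hT hT'
  rwa [le_div_iff₀ hT']

/-- Strict form: if `N(T) → ∞` and `β N(T) ≤ N₀(T)` for all large `T` with `β > α`, then
`α < κ`. [cite: Titchmarsh1986, §10.28 (10.28.1)] -/
theorem lt_criticalLineProportion_of_eventually_mul_le (hN : tendsto_zetaZeroCount_atTop)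
    {α β : ℝ} (hαβ : α < β)
    (h : ∀ᶠ T : ℝ in atTop, β * (zetaZeroCount T : ℝ) ≤ criticalZeroCount T) :
    α < criticalLineProportion :=
  hαβ.trans_le (le_criticalLineProportion_of_eventually_mul_le hN h)

/-- **Reduction of `przz_bound` to the printed large-`T` output of PRZZ.** If `N(T) → ∞` and
`N₀(T) ≥ β N(T)` for all large `T` for some `β > 5/12` — Pratt–Robles–Zaharescu–Zeindler obtain
this from Levinson's inequality of §1.3 (`κ ≥ 1 − R⁻¹ log(T⁻¹ ∫_1^T |Vψ(σ₀+it)|² dt) + o(1)`,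
the mean value being over `[1, T]`) with any
`β < 0.417293962` (§8: `θ = 4/7 − ε`, `R = 1.3036`, `d = 1`, `K = 3` and the printed
`P₁, P₂, P₃, Q`) — then `κ > 5/12`, i.e. `przz_bound`. The analytic input (twisted second moment,
Thm. 4.1; main terms, Thm. 7.1; numerics, §8) is the hypothesis `h`; this lemma is only the final
bookkeeping. [cite: PrattRoblesZaharescuZeindler2020, Thm. 1.2 of arXiv:1802.10521 and §8] -/
theorem przz_bound_of_eventually_mul_le (hN : tendsto_zetaZeroCount_atTop) {β : ℝ}
    (hβ : 5 / 12 < β)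
    (h : ∀ᶠ T : ℝ in atTop, β * (zetaZeroCount T : ℝ) ≤ criticalZeroCount T) :
    przz_bound := by
  unfold przz_bound
  exact lt_criticalLineProportion_of_eventually_mul_le hN hβ h

/-- **From the segment form of Levinson's method to `κ`** (Titchmarsh §10.28: (10.28.7) with
(10.28.11) give `N₀(T₂) − N₀(T₁) ≥ (α + o(1)) {N(T₂) − N(T₁)}` "for suitable `T₁, T₂`", whence
(10.28.1) `N₀(T) ≥ α N(T)` for large `T`). Dyadic version: if `N(T) → ∞` and for every `ε > 0`,
for all large `T`, `(α − ε)(N(2T) − N(T)) ≤ N₀(2T) − N₀(T)`, then `α ≤ κ`.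
Proof: chain the hypothesis along `T, 2T, 4T, …` from a base point in `[T₀, 2T₀)`, so that
`N₀(T') ≥ (α − ε) N(T') − |α − ε| N(2T₀)` for `T' ≥ T₀`; divide by `N(T') → ∞`.
[cite: Titchmarsh1986, §10.28 (10.28.7), (10.28.11), (10.28.1)] -/
theorem le_criticalLineProportion_of_dyadic (hN : tendsto_zetaZeroCount_atTop) {α : ℝ}
    (h : ∀ ε > 0, ∀ᶠ T : ℝ in atTop,
      (α - ε) * ((zetaZeroCount (2 * T) : ℝ) - zetaZeroCount T) ≤
        (criticalZeroCount (2 * T) : ℝ) - criticalZeroCount T) :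
    α ≤ criticalLineProportion := by
  have hN' : Tendsto zetaZeroCount atTop atTop := hN
  -- it suffices to prove `α - 2ε ≤ κ` for every `ε > 0`
  suffices key : ∀ ε > 0, α - 2 * ε ≤ criticalLineProportion by
    refine le_of_forall_pos_le_add fun ε hε ↦ ?_
    have := key (ε / 2) (by positivity)
    linarith
  intro ε hε
  -- a base point `T₀ ≥ 1` beyond which the segment inequality holds
  obtain ⟨T₁, hT₁⟩ := Filter.eventually_atTop.mp (h ε hε)
  set T₀ : ℝ := max T₁ 1 with hT₀_def
  have hT₀1 : 1 ≤ T₀ := le_max_right _ _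
  have hT₀pos : 0 < T₀ := by linarith
  have hP : ∀ T : ℝ, T₀ ≤ T →
      (α - ε) * ((zetaZeroCount (2 * T) : ℝ) - zetaZeroCount T) ≤
        (criticalZeroCount (2 * T) : ℝ) - criticalZeroCount T :=
    fun T hT ↦ hT₁ T ((le_max_left _ _).trans hT)
  -- chain along `T, 2T, …, 2^k T`
  have chain : ∀ k : ℕ, ∀ T : ℝ, T₀ ≤ T →
      (α - ε) * ((zetaZeroCount (2 ^ k * T) : ℝ) - zetaZeroCount T) ≤
        (criticalZeroCount (2 ^ k * T) : ℝ) - criticalZeroCount T := by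
    intro k
    induction k with
    | zero => intro T _; simp
    | succ k ih =>
      intro T hT
      have h2k : T₀ ≤ 2 ^ k * T :=
        hT.trans (le_mul_of_one_le_left (by linarith) (one_le_pow₀ (by norm_num)))
      have hstep := hP (2 ^ k * T) h2k
      have e : (2 : ℝ) * (2 ^ k * T) = 2 ^ (k + 1) * T := by ring
      rw [e] at hstep
      calc (α - ε) * ((zetaZeroCount (2 ^ (k + 1) * T) : ℝ) - zetaZeroCount T)
          = (α - ε) * ((zetaZeroCount (2 ^ (k + 1) * T) : ℝ) - zetaZeroCount (2 ^ k * T)) +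
              (α - ε) * ((zetaZeroCount (2 ^ k * T) : ℝ) - zetaZeroCount T) := by ring
        _ ≤ ((criticalZeroCount (2 ^ (k + 1) * T) : ℝ) - criticalZeroCount (2 ^ k * T)) +
              ((criticalZeroCount (2 ^ k * T) : ℝ) - criticalZeroCount T) :=
            add_le_add hstep (ih T hT)
        _ = (criticalZeroCount (2 ^ (k + 1) * T) : ℝ) - criticalZeroCount T := by ring
  -- the uniform lower bound `(α - ε) N(T') ≤ N₀(T') + C` for `T' ≥ T₀`
  set C : ℝ := |α - ε| * (zetaZeroCount (2 * T₀) : ℝ) with hC_def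
  have hC0 : 0 ≤ C := by positivity
  have lower : ∀ T' : ℝ, T₀ ≤ T' →
      (α - ε) * (zetaZeroCount T' : ℝ) ≤ (criticalZeroCount T' : ℝ) + C := by
    intro T' hT'
    have hx : 1 ≤ T' / T₀ := by rwa [le_div_iff₀ hT₀pos, one_mul]
    obtain ⟨k, hk1, hk2⟩ := exists_nat_pow_near hx one_lt_two
    have h2kpos : (0 : ℝ) < 2 ^ k := by positivity
    set T : ℝ := T' / 2 ^ k with hT_def
    have hTT' : 2 ^ k * T = T' := by rw [hT_def]; field_simp
    have hT₀T : T₀ ≤ T := by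
      rw [hT_def, le_div_iff₀ h2kpos]
      rw [le_div_iff₀ hT₀pos] at hk1
      linarith
    have hT2T₀ : T ≤ 2 * T₀ := by
      rw [hT_def, div_le_iff₀ h2kpos]
      rw [div_lt_iff₀ hT₀pos, pow_succ] at hk2
      linarith
    have hch := chain k T hT₀T
    rw [hTT'] at hch
    have hN₀T : (0 : ℝ) ≤ criticalZeroCount T := Nat.cast_nonneg _
    have hNT : (α - ε) * (zetaZeroCount T : ℝ) ≤ C := by
      calc (α - ε) * (zetaZeroCount T : ℝ) ≤ |α - ε| * (zetaZeroCount T : ℝ) :=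
            mul_le_mul_of_nonneg_right (le_abs_self _) (Nat.cast_nonneg _)
        _ ≤ |α - ε| * (zetaZeroCount (2 * T₀) : ℝ) :=
            mul_le_mul_of_nonneg_left (Nat.cast_le.mpr (zetaZeroCount_mono hT2T₀)) (abs_nonneg _)
    have e : (α - ε) * (zetaZeroCount T' : ℝ) =
        (α - ε) * ((zetaZeroCount T' : ℝ) - zetaZeroCount T) +
          (α - ε) * (zetaZeroCount T : ℝ) := by
      ring
    linarith
  -- divide by `N(T') → ∞`
  have hI := criticalZeroCount_div_zetaZeroCount_mem_Icc_holds
  have hc : IsCoboundedUnder (· ≥ ·) atTop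
      (fun T : ℝ ↦ (criticalZeroCount T : ℝ) / zetaZeroCount T) :=
    isCoboundedUnder_ge_of_le atTop (x := 1) fun T ↦ (hI T).2
  have hpos : ∀ᶠ T : ℝ in atTop, (0 : ℝ) < zetaZeroCount T := by
    filter_upwards [hN'.eventually_ge_atTop 1] with T hT
    exact_mod_cast hT
  have hbig : ∀ᶠ T : ℝ in atTop, C ≤ ε * (zetaZeroCount T : ℝ) := by
    filter_upwards [hN'.eventually_ge_atTop ⌈C / ε⌉₊] with T hT
    have h1 : C / ε ≤ (zetaZeroCount T : ℝ) :=
      (Nat.le_ceil (C / ε)).trans (by exact_mod_cast hT)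
    rwa [div_le_iff₀' hε] at h1
  unfold criticalLineProportion
  refine le_liminf_of_le hc ?_
  filter_upwards [hpos, hbig, eventually_ge_atTop T₀] with T hT hT' hT''
  rw [le_div_iff₀ hT]
  have hl := lower T hT''
  have e : (α - 2 * ε) * (zetaZeroCount T : ℝ) =
      (α - ε) * (zetaZeroCount T : ℝ) - ε * (zetaZeroCount T : ℝ) := by ring
  linarith

/-- **Reduction of `przz_bound` to the segment form of Levinson's method**: if `N(T) → ∞` and,
for some `α > 5/12` and every `ε > 0`, `N₀(2T) − N₀(T) ≥ (α − ε)(N(2T) − N(T))` for all large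
`T` (the dyadic form in which Levinson–Conrey-type results are obtained, Titchmarsh §10.28,
(10.28.7)–(10.28.11); PRZZ §8 gives `α = 0.417293962` with `θ = 4/7 − ε`), then `κ > 5/12`.
Bookkeeping only; the analytic content is the hypothesis `h`.
[cite: PrattRoblesZaharescuZeindler2020, Thm. 1.2 of arXiv:1802.10521 and §8] -/
theorem przz_bound_of_dyadic (hN : tendsto_zetaZeroCount_atTop) {α : ℝ} (hα : 5 / 12 < α)
    (h : ∀ ε > 0, ∀ᶠ T : ℝ in atTop,
      (α - ε) * ((zetaZeroCount (2 * T) : ℝ) - zetaZeroCount T) ≤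
        (criticalZeroCount (2 * T) : ℝ) - criticalZeroCount T) : przz_bound := by
  unfold przz_bound
  exact hα.trans_le (le_criticalLineProportion_of_dyadic hN h)


end Literature.NumberTheory.LFunctions



end
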